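import Literature.Analysis.FluidPDE.AxisymmetricTypeIBoundedProofs
import Literature.Analysis.FluidPDE.CKNLocalRegularityRRSPressure
import HarnessLib

/-!
# Seregin 2014, Ch. 6, Theorem 1.4 (backward CKN criterion) and the off-axis regularity of axisymmetric suitable solutions — discharged

Analysis/FluidPDE glue file **discharging the named facts
`Literature.Analysis.FluidPDE.seregin2014_thm14`** (`SereginEpsilonRegularity.lean`; G. Seregin,
*Lecture Notes on Regularity Theory for the Navier–Stokes Equations*, World Scientific 2014, Ch. 6,
Thm. 1.4: the Caffarelli–Kohn–Nirenberg criterion in the backward form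
`sup_{0<r<1} r⁻¹ ∫_{Q(r)} |∇v|² < ε ⇒ z = 0` regular) **and
`Literature.Analysis.FluidPDE.axisymmetric_typeI_boundedNearTop_offAxis`**
(`AxisymmetricTypeIBounded.lean`; the classical consequence that off-axis points of axisymmetric
suitable weak solutions with finite dissipation are regular). The accepted tree reductions are
`seregin2014_thm14_of_lemma15_12` and `axisymmetric_typeI_boundedNearTop_offAxis_of_lemma15_12`
(`AxisymmetricTypeIBoundedProofs.lean`), both from Robinson–Rodrigo–Sadowski's Lemma 15.12, which is
discharged (`RRS2016.lemma15_12_holds`, `CKNLocalRegularityRRSPressure.lean`).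

Theorem-only glue module: no definitions, no named facts, no `sorry`; each theorem is a
composition of an accepted tree reduction with accepted discharges (pure proof of an
unchanged statement).

## References

* G. Seregin, *Lecture Notes on Regularity Theory for the Navier–Stokes Equations*, World
  Scientific (2014), Ch. 6, §6.1, Thm. 1.4 (PDF p. 94). [Seregin2014]
* L. Caffarelli, R. Kohn, L. Nirenberg, *Partial regularity of suitable weak solutions of the
  Navier–Stokes equations*, Comm. Pure Appl. Math. 35 (1982), Prop. 2, Thm. B. [CKN1982]
* J. C. Robinson, J. L. Rodrigo, W. Sadowski, *The Three-Dimensional Navier–Stokes Equations*,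
  CUP (2016), Lemma 15.12. [RobinsonRodrigoSadowski2016]
-/

noncomputable section

namespace Literature.Analysis.FluidPDE

/-- **Seregin 2014, Ch. 6, Thm. 1.4, proved** (the named statement `seregin2014_thm14`), by
`seregin2014_thm14_of_lemma15_12` and `RRS2016.lemma15_12_holds`. [cite: Seregin2014, Ch. 6 §6.1 Theorem 1.4, PDF p. 94] -/
theorem seregin2014_thm14_holds : seregin2014_thm14 :=
  seregin2014_thm14_of_lemma15_12 RRS2016.lemma15_12_holds

/-- **Off-axis points of axisymmetric suitable weak solutions are regular, proved** (the named
statement `axisymmetric_typeI_boundedNearTop_offAxis`), by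
`axisymmetric_typeI_boundedNearTop_offAxis_of_lemma15_12` and `RRS2016.lemma15_12_holds`. [folklore] -/
theorem axisymmetric_typeI_boundedNearTop_offAxis_holds : axisymmetric_typeI_boundedNearTop_offAxis :=
  axisymmetric_typeI_boundedNearTop_offAxis_of_lemma15_12 RRS2016.lemma15_12_holds

end Literature.Analysis.FluidPDE
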